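import Literature.Topology.FourManifolds.CylinderBoundaryExtension
import Literature.Topology.FourManifolds.CerfTheoremOne
import HarnessLib

/-!
# The reflection of an abstract annulus reverses every orientation

Topic `Literature/Topology/FourManifolds`; written for the fact seat
`provefact-Literature.Topology.FourManifolds.nonempty_diffeomorph_sphere_four_of_sblf_genus_one_noLefschetz`
(torus assembly step of the classification of closed oriented surfaces of genus one: the
orientation characters of the identifications of the two cylinder halves have to be matched,
which needs an orientation-reversing, end-preserving self-diffeomorphism of an abstract annulus).
Everything here is **proved**; no named facts, no new definitions.

## Mathematics

* `det_mfderiv_conj_diffeomorph` — for a diffeomorphism `T : W ≅ V` (possibly between manifolds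
  on different model spaces) and a map `G : V → V` fixing `T w₀`, the Jacobian determinant of the
  conjugate `T⁻¹ ∘ G ∘ T` at `w₀` equals that of `G` at `T w₀`: `d(T⁻¹ ∘ G ∘ T) = dT⁻¹ ∘ dG ∘ dT`
  with `dT⁻¹ = (dT)⁻¹` (chain rule), and the determinant is conjugation invariant
  (`LinearMap.det_conj`).
* `exists_diffeomorph_isOrientationReversing_snd_eq` — **the reflection of an abstract annulus.**
  For an oriented smooth surface with boundary `W` and a diffeomorphism `T : W ≅ 𝕊¹ × [0, 1]`
  there is a self-diffeomorphism `R` of `W` mapping each end to itself (`(T (R w)).2 = (T w).2`)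
  which **reverses** the (any) orientation `Ω` of `W`: the conjugate `R = T⁻¹ ∘ (ρ × id) ∘ T` of
  the product of a reflection `ρ` of `𝕊¹` (`sphereReflection`, `ClosedBallProofs.lean`) with the
  identity of `[0, 1]`.  Proof: `W` is connected, so `R` preserves or reverses `Ω`
  (`Diffeomorph.isOrientationPreserving_or_isOrientationReversing_holds`); at the fixed point
  `w₀ = T⁻¹ (x₁, 0)`, `x₁ ⊥ v`, its Jacobian determinant is
  `det d(ρ × id) = det dρ · det id = -1` (`det_mfderiv_eq_neg_one_of_coe_eq_reflection`,
  `mfderiv_prodMap`, `LinearMap.det_prodMap`), refuting "preserving" (Hirsch, *Differential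
  Topology* (1976), Ch. 4 §4, pp. 105–106: a reflection reverses orientation; the product with an
  identity factor has the same Jacobian sign).

## References

* M. W. Hirsch, *Differential Topology*, GTM 33 (1976), Ch. 4 §4, pp. 101, 105–106; Ch. 5 §1
  (product orientation). [HirschDT1976]
-/

open scoped Manifold ContDiff Topology RealInnerProductSpace
open Function Set Module

noncomputable section

namespace Literature.Topology.FourManifolds

universe u

/-! ### §1 Jacobian of a conjugate -/

section Conj

variable {E F : Type*} [NormedAddCommGroup E] [NormedSpace ℝ E] [NormedAddCommGroup F]
  [NormedSpace ℝ F] {HW HV : Type*} [TopologicalSpace HW] [TopologicalSpace HV]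
  {I : ModelWithCorners ℝ E HW} {J : ModelWithCorners ℝ F HV}
  {W : Type*} [TopologicalSpace W] [ChartedSpace HW W]
  {V : Type*} [TopologicalSpace V] [ChartedSpace HV V]

/-- **The Jacobian determinant of a conjugate.** For a diffeomorphism `T : W ≅ V` and a map
`G : V → V` differentiable at and fixing `T w₀`, the conjugate `T⁻¹ ∘ G ∘ T` has at `w₀` the
Jacobian determinant of `G` at `T w₀` (chain rule, `dT⁻¹ = (dT)⁻¹`, conjugation invariance of
the determinant). [folklore] -/
theorem det_mfderiv_conj_diffeomorph (T : W ≃ₘ⟮I, J⟯ V) {G : V → V} (w₀ : W)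
    (hfix : G (T w₀) = T w₀) (hG : MDifferentiableAt J J G (T w₀)) :
    LinearMap.det (M := E) (mfderiv I I (⇑T.symm ∘ G ∘ ⇑T) w₀).toLinearMap =
      LinearMap.det (M := F) (mfderiv J J G (T w₀)).toLinearMap := by
  have hT : MDifferentiableAt I J T w₀ := T.mdifferentiable (by simp) w₀
  have hTs : MDifferentiableAt J I T.symm (T w₀) := T.symm.mdifferentiable (by simp) (T w₀)
  set A : F →L[ℝ] E := mfderiv J I T.symm (T w₀) with hA
  set B : F →L[ℝ] F := mfderiv J J G (T w₀) with hB
  set C : E →L[ℝ] F := mfderiv I J T w₀ with hC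
  -- `A ∘ C = id`, `C ∘ A = id`
  have hAC : A.comp C = ContinuousLinearMap.id ℝ E := by
    have h : mfderiv I I (⇑T.symm ∘ ⇑T) w₀ = A.comp C := mfderiv_comp w₀ hTs hT
    have hid : (⇑T.symm ∘ ⇑T : W → W) = id := funext fun w => T.symm_apply_apply w
    rw [hid, mfderiv_id] at h
    exact h.symm
  have hCA : C.comp A = ContinuousLinearMap.id ℝ F := by
    have hT' : MDifferentiableAt I J T (T.symm (T w₀)) := by
      rw [Diffeomorph.symm_apply_apply]
      exact hT
    have h : mfderiv J J (⇑T ∘ ⇑T.symm) (T w₀) = (mfderiv I J T (T.symm (T w₀))).comp A :=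
      mfderiv_comp (T w₀) hT' hTs
    have hid : (⇑T ∘ ⇑T.symm : V → V) = id := funext fun y => T.apply_symm_apply y
    rw [hid, mfderiv_id, Diffeomorph.symm_apply_apply] at h
    exact h.symm
  -- the chain rule for the conjugate
  have hGT : MDifferentiableAt I J (G ∘ ⇑T) w₀ := hG.comp w₀ hT
  have hTs' : MDifferentiableAt J I T.symm ((G ∘ ⇑T) w₀) := by
    rw [comp_apply, hfix]
    exact hTs
  have hchain1 : mfderiv I I (⇑T.symm ∘ (G ∘ ⇑T)) w₀ =
      (mfderiv J I T.symm ((G ∘ ⇑T) w₀)).comp (mfderiv I J (G ∘ ⇑T) w₀) :=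
    mfderiv_comp w₀ hTs' hGT
  have hchain2 : mfderiv I J (G ∘ ⇑T) w₀ = B.comp C := mfderiv_comp w₀ hG hT
  have hchain : mfderiv I I (⇑T.symm ∘ G ∘ ⇑T) w₀ = A.comp (B.comp C) := by
    rw [show (⇑T.symm ∘ G ∘ ⇑T) = ⇑T.symm ∘ (G ∘ ⇑T) from rfl, hchain1, hchain2]
    simp only [comp_apply]
    rw [hfix, hA]
    rfl
  rw [hchain]
  -- conjugation invariance of the determinant
  set e : E ≃ₗ[ℝ] F := LinearEquiv.ofLinear (C : E →ₗ[ℝ] F) (A : F →ₗ[ℝ] E)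
    (by
      have := congrArg (fun f : F →L[ℝ] F => (f : F →ₗ[ℝ] F)) hCA
      simpa using this)
    (by
      have := congrArg (fun f : E →L[ℝ] E => (f : E →ₗ[ℝ] E)) hAC
      simpa using this) with he
  have key := LinearMap.det_conj (B : F →ₗ[ℝ] F) e.symm
  rw [LinearEquiv.symm_symm] at key
  exact key

/-- Determinant of a product of endomorphisms given as continuous linear maps
(`LinearMap.det_prodMap`). [folklore] -/
theorem det_coe_prodMap {E₁ E₂ : Type*} [NormedAddCommGroup E₁] [NormedSpace ℝ E₁]
    [FiniteDimensional ℝ E₁] [NormedAddCommGroup E₂] [NormedSpace ℝ E₂] [FiniteDimensional ℝ E₂]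
    (f : E₁ →L[ℝ] E₁) (g : E₂ →L[ℝ] E₂) :
    LinearMap.det ((f.prodMap g : (E₁ × E₂) →L[ℝ] (E₁ × E₂)) : (E₁ × E₂) →ₗ[ℝ] (E₁ × E₂)) =
      LinearMap.det (f : E₁ →ₗ[ℝ] E₁) * LinearMap.det (g : E₂ →ₗ[ℝ] E₂) := by
  rw [ContinuousLinearMap.coe_prodMap, LinearMap.det_prodMap]

end Conj

/-! ### §2 The reflection of an abstract annulus -/

section Annulus

variable {W : Type u} [TopologicalSpace W] [ChartedSpace (EuclideanHalfSpace (1 + 1)) W]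
  [IsManifold (𝓡∂ (1 + 1)) ∞ W]

/-- The annulus `𝕊¹ × [0, 1]` is connected. [folklore] -/
theorem connectedSpace_circle_prod_Icc : ConnectedSpace ((Metric.sphere (0 : EuclideanSpace ℝ (Fin (1 + 1))) 1) × Set.Icc (0 : ℝ) 1) := by
  haveI : ConnectedSpace (Metric.sphere (0 : EuclideanSpace ℝ (Fin (1 + 1))) 1) := by
    refine isConnected_iff_connectedSpace.mp (isConnected_sphere ?_ 0 zero_le_one)
    rw [← Module.finrank_eq_rank, finrank_euclideanSpace_fin]
    norm_num
  haveI : ConnectedSpace (Set.Icc (0 : ℝ) 1) :=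
    isConnected_iff_connectedSpace.mp (isConnected_Icc zero_le_one)
  infer_instance

omit [IsManifold (𝓡∂ (1 + 1)) ∞ W] in
/-- An abstract annulus is connected. [folklore] -/
theorem connectedSpace_of_diffeomorph_annulus
    (T : W ≃ₘ⟮𝓡∂ (1 + 1), (𝓡 1).prod (𝓡∂ 1)⟯ ((Metric.sphere (0 : EuclideanSpace ℝ (Fin (1 + 1))) 1) × Set.Icc (0 : ℝ) 1)) : ConnectedSpace W := by
  haveI := connectedSpace_circle_prod_Icc
  exact T.symm.surjective.connectedSpace T.symm.continuous

/-- **The reflection of an abstract annulus reverses every orientation.** Let `W` be a smooth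
surface with boundary, `T : W ≅ 𝕊¹ × [0, 1]` a diffeomorphism and `Ω` a smooth orientation of `W`.
Then there is a self-diffeomorphism `R` of `W` which maps each end of `W` to itself
(`(T (R w)).2 = (T w).2`, and the same for `R⁻¹`) and reverses `Ω`: the conjugate by `T` of
`ρ × id`, `ρ` a reflection of the circle.  (The connected `W` makes `R` preserve or reverse `Ω`;
at a fixed point its Jacobian determinant is `det dρ · det id = -1`.) Hirsch, *Differential
Topology* (1976), Ch. 4 §4, pp. 105–106. [cite: HirschDT1976, Ch. 4 §4, pp. 105–106] -/
theorem exists_diffeomorph_isOrientationReversing_snd_eq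
    (T : W ≃ₘ⟮𝓡∂ (1 + 1), (𝓡 1).prod (𝓡∂ 1)⟯ ((Metric.sphere (0 : EuclideanSpace ℝ (Fin (1 + 1))) 1) × Set.Icc (0 : ℝ) 1))
    (Ω : SmoothOrientation (𝓡∂ (1 + 1)) W) :
    ∃ R : W ≃ₘ⟮𝓡∂ (1 + 1), 𝓡∂ (1 + 1)⟯ W, (∀ w, (T (R w)).2 = (T w).2) ∧
      (∀ w, (T (R.symm w)).2 = (T w).2) ∧ R.IsOrientationReversing Ω Ω := by
  haveI : Fact (finrank ℝ (EuclideanSpace ℝ (Fin (1 + 1))) = 1 + 1) :=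
    ⟨finrank_euclideanSpace_fin⟩
  set v : (Metric.sphere (0 : EuclideanSpace ℝ (Fin (1 + 1))) 1) := sphereBasePoint 1 with hv_def
  set ρ := sphereReflection v with hρ
  set P : ((Metric.sphere (0 : EuclideanSpace ℝ (Fin (1 + 1))) 1) × Set.Icc (0 : ℝ) 1) ≃ₘ⟮(𝓡 1).prod (𝓡∂ 1), (𝓡 1).prod (𝓡∂ 1)⟯
      ((Metric.sphere (0 : EuclideanSpace ℝ (Fin (1 + 1))) 1) × Set.Icc (0 : ℝ) 1) :=
    ρ.prodCongr (Diffeomorph.refl (𝓡∂ 1) (Set.Icc (0 : ℝ) 1) ∞) with hP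
  have hPapp : ∀ q, P q = (ρ q.1, q.2) := fun q => rfl
  set R : W ≃ₘ⟮𝓡∂ (1 + 1), 𝓡∂ (1 + 1)⟯ W := T.trans (P.trans T.symm) with hR
  have hRapp : ∀ w, R w = T.symm (P (T w)) := fun w => rfl
  have hRsymm : ∀ w, R.symm w = T.symm (P.symm (T w)) := fun w => rfl
  refine ⟨R, fun w => ?_, fun w => ?_, ?_⟩
  · rw [hRapp, Diffeomorph.apply_symm_apply, hPapp]
  · rw [hRsymm, Diffeomorph.apply_symm_apply, hP, Diffeomorph.prodCongr_symm]
    rfl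
  -- `R` preserves or reverses `Ω`; preserving is refuted at a fixed point
  haveI := connectedSpace_of_diffeomorph_annulus T
  rcases Diffeomorph.isOrientationPreserving_or_isOrientationReversing_holds R (by simp) Ω Ω
    with h | h
  · exfalso
    have hv : (v : EuclideanSpace ℝ (Fin (1 + 1))) ≠ 0 := ne_zero_of_mem_unit_sphere v
    obtain ⟨x₁, hx₁⟩ := exists_mem_sphere_inner_eq_zero one_ne_zero v
    have hφ : ∀ x : (Metric.sphere (0 : EuclideanSpace ℝ (Fin (1 + 1))) 1), ((ρ x : (Metric.sphere (0 : EuclideanSpace ℝ (Fin (1 + 1))) 1)) : EuclideanSpace ℝ (Fin (1 + 1))) =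
        ((ℝ ∙ (v : EuclideanSpace ℝ (Fin (1 + 1))))ᗮ).reflection
          (x : EuclideanSpace ℝ (Fin (1 + 1))) := fun _ => rfl
    have hρx₁ : ρ x₁ = x₁ := eq_self_of_coe_eq_reflection hφ hx₁
    set w₀ : W := T.symm (x₁, ⊥) with hw₀
    have hTw₀ : T w₀ = (x₁, ⊥) := by rw [hw₀, Diffeomorph.apply_symm_apply]
    have hfix : P (T w₀) = T w₀ := by rw [hTw₀, hPapp, hρx₁]
    have hRw₀ : R w₀ = w₀ := by rw [hRapp, hfix, Diffeomorph.symm_apply_apply]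
    -- "preserving at `w₀`" forces a positive Jacobian determinant
    have hpos : 0 < LinearMap.det (M := EuclideanSpace ℝ (Fin (1 + 1)))
        (mfderiv (𝓡∂ (1 + 1)) (𝓡∂ (1 + 1)) R w₀).toLinearMap := (h w₀).mp (by rw [hRw₀])
    -- but it equals `det d(ρ × id) = det dρ · det id = -1`
    have hPd : MDifferentiableAt ((𝓡 1).prod (𝓡∂ 1)) ((𝓡 1).prod (𝓡∂ 1)) P (T w₀) :=
      P.mdifferentiable (by simp) _
    have hconj := det_mfderiv_conj_diffeomorph T w₀ hfix hPd
    have hcoe : (⇑T.symm ∘ ⇑P ∘ ⇑T : W → W) = ⇑R := funext fun w => (hRapp w).symm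
    rw [hcoe] at hconj
    have hρd : MDifferentiableAt (𝓡 1) (𝓡 1) ρ x₁ := ρ.mdifferentiable (by simp) x₁
    have hidd : MDifferentiableAt (𝓡∂ 1) (𝓡∂ 1) (id : Set.Icc (0 : ℝ) 1 → Set.Icc (0 : ℝ) 1)
        (⊥ : Set.Icc (0 : ℝ) 1) := mdifferentiableAt_id
    have hPmap : (⇑P : (Metric.sphere (0 : EuclideanSpace ℝ (Fin (1 + 1))) 1) × Set.Icc (0 : ℝ) 1 → (Metric.sphere (0 : EuclideanSpace ℝ (Fin (1 + 1))) 1) × Set.Icc (0 : ℝ) 1) = Prod.map ρ id := by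
      funext q
      rw [hPapp]
      rfl
    set f : EuclideanSpace ℝ (Fin 1) →L[ℝ] EuclideanSpace ℝ (Fin 1) :=
      mfderiv (𝓡 1) (𝓡 1) ρ x₁ with hf
    set g : EuclideanSpace ℝ (Fin 1) →L[ℝ] EuclideanSpace ℝ (Fin 1) :=
      mfderiv (𝓡∂ 1) (𝓡∂ 1) (id : Set.Icc (0 : ℝ) 1 → Set.Icc (0 : ℝ) 1) ⊥ with hg
    have hprod : (mfderiv ((𝓡 1).prod (𝓡∂ 1)) ((𝓡 1).prod (𝓡∂ 1)) P (T w₀) :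
        (EuclideanSpace ℝ (Fin 1) × EuclideanSpace ℝ (Fin 1)) →L[ℝ]
          (EuclideanSpace ℝ (Fin 1) × EuclideanSpace ℝ (Fin 1))) = f.prodMap g := by
      rw [hPmap, hTw₀]
      exact mfderiv_prodMap hρd hidd
    have hdetf : LinearMap.det (f : EuclideanSpace ℝ (Fin 1) →ₗ[ℝ] EuclideanSpace ℝ (Fin 1)) =
        -1 := det_mfderiv_eq_neg_one_of_coe_eq_reflection hv hφ hx₁ hρd
    have hg' : g = ContinuousLinearMap.id ℝ (EuclideanSpace ℝ (Fin 1)) := by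
      rw [hg]
      exact mfderiv_id
    have hdetP : LinearMap.det (M := EuclideanSpace ℝ (Fin 1) × EuclideanSpace ℝ (Fin 1))
        (mfderiv ((𝓡 1).prod (𝓡∂ 1)) ((𝓡 1).prod (𝓡∂ 1)) P (T w₀)).toLinearMap = -1 := by
      have h3 := det_coe_prodMap f g
      rw [hprod]
      refine h3.trans ?_
      rw [hdetf, hg', ContinuousLinearMap.coe_id, LinearMap.det_id, mul_one]
    rw [hconj, hdetP] at hpos
    norm_num at hpos
  · exact h

end Annulus

end Literature.Topology.FourManifolds
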